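import Summits.QuantumFields.YangMills.Theorems.BalabanUVNodesN07Thm1Top7FromProp8
import Literature.MathematicalPhysics.QuantumFieldTheory.Balaban1983to89.Node00.Record12BgRowCoClassCPMFloor

/-!
# BalabanUVNodes ∕ N07 ([Balaban1985Variational] Thm 1 (6)–(8) ∕ Prop. 8 p. 304) — THE FLOOR-CARRYING (8)-SENTENCE `VariationalThm1RegSepTop7MR ∕ …CoP7MR … c …`
# (Node00 module 49) FROM THE FLOOR-CARRYING TOP STEP OF PROPOSITION 8 (`Node00.Prop8RegSepTopStepR … c …`, module 46): `…N07Thm1Top7FromProp8` with ONE binder threaded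

Cell `pub-ymgap` (HUMAN RULINGS D-0062 ∕ D-0088), seat `pub-ymgap-dag-n07-e` generation 20 (R141 (C) row s3 lineage; DAG node N07 = [B11]; lane owner).
`--kind proof --supports stmt-QuantumFields-20541 --as helper` (K0⁷; count-neutral).  THEOREMS ONLY (0 `def`, 0 `sorry`).  Item (c2) of LOCATED-STUB1-FLOOR's CONSUMER-SIDE
CENSUS (cell bus 2026-08-28 09:47Z): under the V20 reading of stub 1 (`∃ c B₃ a₀ a₁, … Prop8RegSepTopStepR F 2 suppDom c B₃ a₀ a₁`) the (8)-sentence the K0 body consumes is the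
floor-carrying `VariationalThm1RegSepCoP7MR F 2 c B₃ a₀ a₁`; this file derives it exactly as the floor-free twin did — at `k ≥ 1` by module 49's
`regular_of_isMinimizer_classTop_of_prop8TopStepR` (minimal ⇒ critical ⇒ Prop. 8, at numerics meeting the floor), at `k = 0` by flatness of the unconstrained minimiser
(`dist1_plaqHol_eq_zero_of_isMinimizer_classTop_zero`, floor-blind).

WHAT IS PROVED.  ★ `variationalThm1RegSepTop7MR_of_prop8TopStepR (Sup) (hB : 0 < B₃) (h8 : Prop8RegSepTopStepR F N Sup c B₃ a₀ a₁) : VariationalThm1RegSepTop7MR F N Sup c B₃ a₀ a₁`,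
★ `variationalThm1RegSepCoP7MR_of_prop8TopStepR` (at `Sup := suppDomOfRecord`, definitional), and the HalvingStep-sourced form `variationalThm1RegSepCoP7MR_of_halvingStepTopR`
(module 46 §4's `prop8RegSepTopStepR_of_halvingStepTopR`).
HONEST FRAMING: count-neutral kernel bookkeeping; Prop. 8 NOT claimed in either reading; nothing of Bałaban asserted; `stub_prop8StepCoP13` ∕ K0⁷ NOT closed; N07 NOT discharged
(5∕27); counts unmoved (28∕28); one finite 𝕋⁴ programme at fixed ε — R4 closes the conditional finite-𝕋⁴ rung `BalabanLadder.UV` only; NOT continuum ∕ ℝ⁴ ∕ OS ∕ mass gap ∕ Clay.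

DEPENDENCES (by name): this seat's `…N07Thm1Top7FromProp8.dist1_plaqHol_eq_zero_of_isMinimizer_classTop_zero`, Node00 module 46 `Prop8RegSepTopStepR`,
`prop8RegSepTopStepR_of_halvingStepTopR`, module 49 `VariationalThm1RegSepTop7MR ∕ …CoP7MR`, `regular_of_isMinimizer_classTop_of_prop8TopStepR`, part A1 `norm_coDivSum_le`.
[B11] = [Balaban1985Variational] Thm 1 (6)–(8) pp.278–279, p.299, Prop. 8 p.304, p.304 lines 1–2; [6] = [Balaban1985RegularSpaces] (1.3)–(1.10) p.77; [III] = [Balaban1988Convergent] (2.12) p.256.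
-/

noncomputable section

namespace Summit.QuantumFields.YangMills.BalabanUVNodes.N07Thm1Top7FromProp8

open Literature.MathematicalPhysics.QuantumFieldTheory.Balaban1983to89
open Literature.MathematicalPhysics.QuantumFieldTheory.Balaban1983to89.T4Continuum (T4Family)
open Literature.MathematicalPhysics.QuantumFieldTheory.Balaban1983to89.Node00
open Literature.MathematicalPhysics.QuantumFieldTheory.Balaban1983to89.B15DeterminingSets
open Summit.QuantumFields.YangMills.BalabanUVNodes.N07FaceDatumAverage (norm_coDivSum_le)
open scoped Matrix.Norms.L2Operator

variable {F : T4Family} {N : ℕ} [NeZero N]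

/-- ★ **THE FLOOR-CARRYING GUARDED TOP-DOMAIN (8)-SENTENCE (Node00 module 49) FROM THE FLOOR-CARRYING TOP STEP OF PROPOSITION 8 (module 46)**, for `0 < B₃` and ANY support
selector `Sup`: at a genuine step by `regular_of_isMinimizer_classTop_of_prop8TopStepR` at numerics meeting the floor (`hc` threaded), at `k = 0` by flatness of the unconstrained
minimiser (floor-blind). [cite: Balaban1985Variational, Thm 1 (6)–(8) pp.278–279, p.299, Prop. 8 p.304, p.304 lines 1–2; Balaban1985RegularSpaces, (1.3)–(1.6) p.77; Balaban1988Convergent, (2.12) p.256] -/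
theorem variationalThm1RegSepTop7MR_of_prop8TopStepR (Sup : (ν : Stage7Numerics) → (K : ℕ) → (ℕ → Set (Site (F.P K) 0)) → Set (Site (F.P K) 0))
    {c : ℕ} {B₃ a₀ a₁ : ℝ} (hB : 0 < B₃) (h8 : Prop8RegSepTopStepR F N Sup c B₃ a₀ a₁) :
    VariationalThm1RegSepTop7MR F N Sup c B₃ a₀ a₁ := by
  intro ν M g K k s hsep hM₁ hc ε₀ δ hδ hcomp hcomp' hε₀ W h7 U₀ hU₀
  rcases Nat.eq_zero_or_pos k with rfl | hk
  · -- `k = 0`: the unconstrained minimiser is flat (no floor is read)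
    have hε₀pos : 0 < ε₀ := lt_of_lt_of_le (mul_pos hB (hδ 0 le_rfl).1) (hδ 0 le_rfl).2.2
    have hη : ∀ n, 0 < (F.P K).eta n := fun n => pow_pos (inv_pos.mpr (by exact_mod_cast (F.P K).L_pos)) n
    have hflat : ∀ q, dist1 (GaugeField.plaqHol U₀ q) ≤ 0 := fun q =>
      le_of_eq (dist1_plaqHol_eq_zero_of_isMinimizer_classTop_zero s hε₀pos hU₀ q)
    refine ⟨fun n hn q _ => (hflat q).trans_lt (mul_pos (mul_pos hB (hδ n hn).1) (pow_pos (hη n) 2)), fun n hn b _ => ?_⟩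
    have h := norm_coDivSum_le U₀ le_rfl hflat b.src b.dir
    rw [mul_zero, mul_zero] at h
    exact h.trans_lt (mul_pos (mul_pos hB (hδ n hn).1) (pow_pos (hη n) 3))
  · exact regular_of_isMinimizer_classTop_of_prop8TopStepR h8 ν M g K k s hsep hM₁ hc hk ε₀ δ hδ hcomp hcomp' hε₀ W h7 hU₀

/-- ★ **THE FLOOR-CARRYING GUARDED `CoP` (8)-SENTENCE FROM PROPOSITION 8's FLOOR-CARRYING TOP STEP** at def-R's support selector: `VariationalThm1RegSepCoP7MR` IS
`VariationalThm1RegSepTop7MR` at `Sup := suppDomOfRecord` (module 49, definitional). [cite: Balaban1985Variational, Thm 1 (6)–(8) pp.278–279, Prop. 8 p.304, p.304 lines 1–2] -/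
theorem variationalThm1RegSepCoP7MR_of_prop8TopStepR {c : ℕ} {B₃ a₀ a₁ : ℝ} (hB : 0 < B₃)
    (h8 : Prop8RegSepTopStepR F N (fun ν K Ω => suppDomOfRecord F ν K Ω) c B₃ a₀ a₁) :
    VariationalThm1RegSepCoP7MR F N c B₃ a₀ a₁ :=
  (variationalThm1RegSepTop7MR_of_prop8TopStepR (fun ν K Ω => suppDomOfRecord F ν K Ω) hB h8).toCoP7MR

/-- The `CoP` (8)-sentence at floor `c` from Sect. F's floor-carrying ONE-STEP fact (module 46 §4: `HalvingStepTopR c ⇒ Prop8RegSepTopStepR c` at `0 < B₃`).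
[cite: Balaban1985Variational, Thm 1 (6)–(8) pp.278–279, Sect. F p.304, Prop. 8 p.304 (bookkeeping)] -/
theorem variationalThm1RegSepCoP7MR_of_halvingStepTopR {c : ℕ} {B₃ a₀ a₁ : ℝ} (hB : 0 < B₃)
    (hH : HalvingStepTopR F N (fun ν K Ω => suppDomOfRecord F ν K Ω) c B₃ a₀ a₁) :
    VariationalThm1RegSepCoP7MR F N c B₃ a₀ a₁ :=
  variationalThm1RegSepCoP7MR_of_prop8TopStepR hB (prop8RegSepTopStepR_of_halvingStepTopR hB hH)

end Summit.QuantumFields.YangMills.BalabanUVNodes.N07Thm1Top7FromProp8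

end
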